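import Mathlib
import HarnessLib
import Summits.MatrixMultiplication.MatrixMultiplication.Theorems.OutsiderSandwichSegreLemmas
import Summits.MatrixMultiplication.MatrixMultiplication.Theorems.OutsiderSandwichSubrankSix
import Summits.MatrixMultiplication.MatrixMultiplication.Theorems.OutsiderSandwichPackingSlack

/-!
# OutsiderSandwich — `2·⟨2,2,2⟩ ≰ cw₂^{⊠2}` by SEGRE TRANSPORT: the smallest matrix-packing cell of
the `cw₂`-tower sits strictly below both pencil laws
(decomp-mm lens 4 «minimal-counterexample / extremal reduction», gen 42, kernel K42-a part 2;
THESES-FREE, DEFINITION-FREE, `ω`-free)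

MAIN THEOREMS. `not_pack_two_two_le_diagPow_two` / `not_pack_two_two_le_cwPow_two`:
`⟨2⟩ ⊗ ⟨2,2,2⟩ = 2·⟨2,2,2⟩` is NOT a restriction of `D^{⊠2}` (the Kronecker square of the diagonalised
Coppersmith–Winograd tensor `D = x₀x₁x₂`), hence not of `cw₂^{⊠2} ≤ D^{⊠2}`.  Together with the
exact gluing `⟨2,2,2⟩ ⊕ ⟨1⟩ ≤ cw₂^{⊠2}` (`OutsiderSandwichMMPlusPoint`) the cell `(N, m) = (2, 2)` of
the packing census `max {F : F·⟨m,m,m⟩ ≤ cw₂^{⊠N}}` is DECIDED: `F = 1`, whereas the slack law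
(`OutsiderSandwichPackingSlack.slack_law`: `2^N + 2Fm² ≤ m + 2·3^N`, here `4 + 16 ≤ 20`) and the copy
law (`12 + 32 ≤ 44`) are both tight at `F = 2` — the first census cell whose value lies strictly
below every slice-rank (pencil) bound of the lineage, and the minimal instance of the lens
(smallest `N`, smallest genuine matrix block).

MECHANISM (new for the lineage: "Segre transport").  A restriction `(A, B, C)` of the concise target
makes the transposed first map `ξ ↦ ξᵀA : ℂ⁸ → ℂ⁹` injective and, by Sylvester-with-slack
(`rank_le_rank_sandwich_add`, formats `8 → 9` twice), carries a covector `ξ` whose target slice has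
rank `r` to a covector `θ` of `D^{⊠2}` with `rank T₂(θ) ≤ r + 2`.  The rank-one block covectors
`ξ_{f,u,v}` (a `2 × 2` rank-one matrix `u vᵀ` in block `f`; slice rank `2`,
`rank_sliceMat_pack_rankOne_le`) therefore land in the layer `rank T₂ ≤ 4 < 6`, which by the slice
gap (`OutsiderSandwichSliceGap.exists_prod_two`, `det D(λ) = 2λ₀λ₁λ₂`) consists of the products
`λ ⊗ μ` with a vanishing coordinate in each factor (`exists_singular_prod`).  So each block yields a
LINEAR INJECTIVE map of `ℂ^{2×2}` into `ℂ^{3×3}` sending the whole Segre cone `{u vᵀ}` into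
`{λ μᵀ : λ, μ singular}`; the cross lemma (`OutsiderSandwichSegreLemmas.cross_of_bilinear_rank_one`,
a rank-one-preserver rigidity statement) confines its image to a cross space `P_a ⊗ P_b`
(`dim 4`).  Two cross spaces always have two common vanishing words, so the `8`-dimensional image of
`ξ ↦ ξᵀA` sits in a `7`-space (`false_of_range_vanishes`) — contradiction.  No slice-rank count can
see this: the obstruction is the GEOMETRY of the minimal slice layer, not its rank values.

Scope (honest): the transport bites only when the rank-one target slices plus the Sylvester
slack stay inside the minimal layer, `m + 2·(3^N − F·m²) < 3·2^{N-1}` (heuristically the second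
slice layer of `D^{⊠N}`; proved as the gap `4 < 6` only at `N = 2`): true at `(N,m,F) = (2,2,2)`,
while for `N ≥ 3` every cell satisfying it is already excluded by the copy law
(`OutsiderSandwichPackingSlack.slack_law_copies`) — the `N ≥ 3` census cells need the geometry of
the HIGHER slice layers of `D^{⊠N}`, not formalised here.  Bearing on the cut: necessity side of
`LaserTangency` (packings `⟨B⟩ ⊠ ⟨m,m,m⟩ ≤ cw₂^{⊠N}`): the first exactly decided matrix cell, one
full unit (`F = 1` vs `2`) below the pencil ceiling — a `50%` capacity deficit at `N = 2`, of the
kind the laser method's `o(N)`-exponent losses must absorb, but at fixed `N` only.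

References: [cite: CoppersmithWinograd1990, §6]; [cite: Blaser2013, §5];
[cite: BurgisserClausenShokrollahi1997, (15.25)]; [cite: HornJohnson2013, §0.4];
[cite: ChristandlVranaZuiddam2023, §1.1]; [cite: LandsbergGCT2017, §3.4.9].
-/

set_option linter.dupNamespace false

namespace Summit.MatrixMultiplication.MatrixMultiplication.Theorems.OutsiderSandwichSegreTransport

open Literature.Computability.AlgebraicComplexity
open Summit.MatrixMultiplication.MatrixMultiplication.Theorems.OutsiderSandwichNoExactPerfection
  (sliceMat sliceMat_restricts restricts_rotate toLin'_injective_of_restricts)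
open Summit.MatrixMultiplication.MatrixMultiplication.Theorems.OutsiderSandwichNoExactPerfectPacking
  (linearIndependent_pack linearIndependent_rotate_pack linearIndependent_rotate_rotate_pack)
open Summit.MatrixMultiplication.MatrixMultiplication.Theorems.OutsiderSandwichPackingSlack
  (rank_le_rank_sandwich_add sliceMat_eq_contract3)
open Summit.MatrixMultiplication.MatrixMultiplication.Theorems.OutsiderSandwichSliceGap
  (exists_prod_two det_dslice)
open Summit.MatrixMultiplication.MatrixMultiplication.Theorems.OutsiderSandwichSubrankSix
  (diagPow_two_restrictsTo_cwPow_two)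
open Summit.MatrixMultiplication.MatrixMultiplication.Theorems.OutsiderSandwichSegreLemmas
  (cross_of_bilinear_rank_one)
open scoped Matrix BigOperators

variable {D : Fin 3 → Fin 3 → Fin 3 → ℂ}

/-! ## §1  The minimal slice layer of `D^{⊠2}`: singular products -/

/-- **Slice gap, coordinate form.**  A non-zero covector `θ` on words of length `2` whose slice
`T₂(θ)` has rank `≤ 5` is a product `λ ⊗ μ` with `λ` AND `μ` each having a vanishing coordinate
(`det D(λ) = 2 λ₀ λ₁ λ₂` and `D(λ)`, `D(μ)` are singular). [cite: CoppersmithWinograd1990, §6] -/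
theorem exists_singular_prod (hD : ∀ a b c, D a b c = if a ≠ b ∧ b ≠ c ∧ a ≠ c then 1 else 0)
    (θ : (Fin 2 → Fin 3) → ℂ) (hθ : θ ≠ 0) (hr : (contract3 (kroneckerPow D 2) θ).rank ≤ 5) :
    ∃ lam mu : Fin 3 → ℂ, (∃ a, lam a = 0) ∧ (∃ b, mu b = 0) ∧
      θ = fun w => lam (w 0) * mu (w 1) := by
  classical
  obtain ⟨lam, mu, xh, yh, hprod, hx0, hx, hy0, hy⟩ := exists_prod_two hD θ hθ hr
  have hdl : (contract3 D lam).det = 0 := Matrix.exists_mulVec_eq_zero_iff.mp ⟨xh, hx0, hx⟩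
  have hdm : (contract3 D mu).det = 0 := Matrix.exists_mulVec_eq_zero_iff.mp ⟨yh, hy0, hy⟩
  rw [det_dslice hD] at hdl hdm
  have key : ∀ z : Fin 3 → ℂ, 2 * z 0 * z 1 * z 2 = 0 → ∃ a, z a = 0 := by
    intro z hz
    rcases mul_eq_zero.mp hz with h | h
    · rcases mul_eq_zero.mp h with h | h
      · rcases mul_eq_zero.mp h with h | h
        · norm_num at h
        · exact ⟨0, h⟩
      · exact ⟨1, h⟩
    · exact ⟨2, h⟩
  exact ⟨lam, mu, key lam hdl, key mu hdm, hprod⟩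

/-! ## §2  Rank-one block covectors of `⟨F⟩ ⊗ ⟨m,m,m⟩` have slices of rank `≤ m` -/

/-- **Rank-one slices of the packing target.**  The first-mode slice of `⟨F⟩ ⊗ ⟨m,m,m⟩` at the
block covector `ξ_{f,u,v}((f',(κ,ν))) = [f' = f] u_κ v_ν` (a rank-one `m × m` matrix `u vᵀ` placed in
block `f`) factors through `ℂ^m`, hence has rank `≤ m` (`= m · rank(u vᵀ)`: the slice of `⟨m,m,m⟩`
at `Z` is `Z ⊗ I_m` up to the standard relabelling). [cite: Blaser2013, §5] -/
theorem rank_sliceMat_pack_rankOne_le (F m : ℕ) (f : Fin F) (u v : Fin m → ℂ) :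
    (sliceMat (kroneckerTensor (unitTensor ℂ F) (matMulTensor ℂ m m m))
      (fun a => if a.1 = f then u a.2.1 * v a.2.2 else 0)).rank ≤ m := by
  classical
  let P : Matrix (Fin F × (Fin m × Fin m)) (Fin m) ℂ :=
    Matrix.of fun b j => if b.1 = f ∧ b.2.2 = j then u b.2.1 else 0
  let Q : Matrix (Fin m) (Fin F × (Fin m × Fin m)) ℂ :=
    Matrix.of fun j c => if c.1 = f ∧ c.2.1 = j then v c.2.2 else 0
  have hPQ : sliceMat (kroneckerTensor (unitTensor ℂ F) (matMulTensor ℂ m m m))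
      (fun a => if a.1 = f then u a.2.1 * v a.2.2 else 0) = P * Q := by
    ext b c
    simp only [sliceMat, Matrix.of_apply, Matrix.mul_apply, kroneckerTensor_apply,
      unitTensor_apply, matMulTensor, P, Q]
    rw [Fintype.sum_eq_single (b.1, (b.2.1, c.2.2)), Fintype.sum_eq_single b.2.2]
    · by_cases h1 : b.1 = f <;> by_cases h2 : c.1 = f <;> by_cases h3 : b.2.2 = c.2.1 <;>
        simp [h1, h2, h3] <;> (intro h; simp_all)
    · intro j hj
      simp [Ne.symm hj]
    · rintro ⟨a1, a2, a3⟩ ha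
      have : ¬ (a1 = b.1 ∧ a2 = b.2.1 ∧ a3 = c.2.2) := fun h => ha (by rw [h.1, h.2.1, h.2.2])
      by_cases k1 : a1 = b.1 <;> by_cases k2 : a2 = b.2.1 <;> by_cases k3 : a3 = c.2.2 <;>
        simp_all
  rw [hPQ]
  calc (P * Q).rank ≤ P.rank := Matrix.rank_mul_le_left P Q
    _ ≤ Fintype.card (Fin m) := Matrix.rank_le_card_width P
    _ = m := Fintype.card_fin m

/-! ## §3  Too many common zeros: an injective `ℂ⁸ → ℂ⁹` cannot vanish at two coordinates -/

/-- If `ξ ↦ ξᵀA : ℂ^Q → ℂ^{3×3}` (`#Q = 8`) is injective, its images cannot all vanish at two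
distinct words `w₁ ≠ w₂` (`8 ≤ 9 - 2` is false). [cite: HornJohnson2013, §0.4] -/
theorem false_of_range_vanishes {Q : Type*} [Fintype Q] [DecidableEq Q] (hQ : Fintype.card Q = 8)
    {A : Q → (Fin 2 → Fin 3) → ℂ} (hA : Function.Injective (Matrix.toLin' (Matrix.of A)ᵀ))
    {w₁ w₂ : Fin 2 → Fin 3} (hw : w₁ ≠ w₂)
    (hv : ∀ q, Matrix.toLin' (Matrix.of A)ᵀ (Pi.single q 1) w₁ = 0 ∧
      Matrix.toLin' (Matrix.of A)ᵀ (Pi.single q 1) w₂ = 0) : False := by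
  classical
  set T := Matrix.toLin' (Matrix.of A)ᵀ with hT
  let π : ((Fin 2 → Fin 3) → ℂ) →ₗ[ℂ] ℂ × ℂ := (LinearMap.proj w₁).prod (LinearMap.proj w₂)
  have hcomp : π ∘ₗ T = 0 := by
    refine LinearMap.pi_ext (fun q c => ?_)
    have hsc : (Pi.single q c : Q → ℂ) = c • (Pi.single q (1 : ℂ) : Q → ℂ) := by
      ext q'
      by_cases h : q' = q
      · subst h; simp
      · simp [h]
    rw [LinearMap.zero_apply, hsc, map_smul, LinearMap.comp_apply]
    have : π (T (Pi.single q 1)) = 0 := by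
      ext
      · simpa [π] using (hv q).1
      · simpa [π] using (hv q).2
    rw [this, smul_zero]
  have hle : LinearMap.range T ≤ LinearMap.ker π := by
    rintro _ ⟨ξ, rfl⟩
    rw [LinearMap.mem_ker, ← LinearMap.comp_apply, hcomp, LinearMap.zero_apply]
  have hsurj : Function.Surjective π := by
    rintro ⟨s, t⟩
    refine ⟨Pi.single w₁ s + Pi.single w₂ t, ?_⟩
    simp [π, hw, hw.symm]
  have h1 : Module.finrank ℂ (LinearMap.range T) = 8 := by
    rw [LinearMap.finrank_range_of_inj hA, Module.finrank_fintype_fun_eq_card, hQ]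
  have h2 : Module.finrank ℂ (LinearMap.ker π) + 2 = 9 := by
    have h := LinearMap.finrank_range_add_finrank_ker π
    rw [LinearMap.range_eq_top.mpr hsurj, finrank_top] at h
    simp only [Module.finrank_prod, Module.finrank_self, Module.finrank_fintype_fun_eq_card,
      Fintype.card_fun, Fintype.card_fin] at h
    omega
  have := Submodule.finrank_mono hle
  omega

/-! ## §4  `2·⟨2,2,2⟩ ≰ D^{⊠2}` and `2·⟨2,2,2⟩ ≰ cw₂^{⊠2}` -/

/-- **`2·⟨2,2,2⟩ ≰ D^{⊠2}` (Segre transport).**  The Kronecker square of the diagonalised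
Coppersmith–Winograd tensor does not restrict to two disjoint copies of `⟨2,2,2⟩`, although both
pencil laws of the tower are TIGHT at this cell (`slack_law`: `4 + 16 ≤ 2 + 18`; copy law:
`12 + 32 ≤ 44`).  Proof: a restriction `(A,B,C)` makes `ξ ↦ ξᵀA` injective (`ℂ⁸ ↪ ℂ⁹`, conciseness)
and carries every rank-one block covector `ξ_{f,u,v}` (slice rank `2` in the target) to a covector
`θ` with `rank T₂(θ) ≤ 2 + 1 + 1 ≤ 5` (Sylvester with slack), i.e. into the minimal slice layer:
`θ = λ ⊗ μ` with `λ`, `μ` each having a zero coordinate (`exists_singular_prod`).  By the cross lemma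
(`OutsiderSandwichSegreLemmas.cross_of_bilinear_rank_one`) each block's image lies in a cross space
`P_{a_f} ⊗ P_{b_f}`; two such `4`-spaces always leave two common vanishing words, so the `8`
independent images live in a `7`-space — contradiction. [new] -/
theorem not_pack_two_two_le_diagPow_two
    (hD : ∀ a b c, D a b c = if a ≠ b ∧ b ≠ c ∧ a ≠ c then 1 else 0) :
    ¬ TensorRestrictsTo (kroneckerPow D 2)
      (kroneckerTensor (unitTensor ℂ 2) (matMulTensor ℂ 2 2 2)) := by
  classical
  rintro ⟨A, B, C, hs⟩
  have hA := toLin'_injective_of_restricts hs (linearIndependent_pack 2 2)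
  have hB := toLin'_injective_of_restricts (restricts_rotate hs) (linearIndependent_rotate_pack 2 2)
  have hC := toLin'_injective_of_restricts (restricts_rotate (restricts_rotate hs))
    (linearIndependent_rotate_rotate_pack 2 2)
  set T := Matrix.toLin' (Matrix.of A)ᵀ with hT
  have hTξ : ∀ ξ, T ξ = ξ ᵥ* Matrix.of A := fun ξ => by
    rw [hT, Matrix.toLin'_apply, Matrix.mulVec_transpose]
  -- the bridge from covectors on words of length two to `3 × 3` matrices
  let br : ((Fin 2 → Fin 3) → ℂ) →ₗ[ℂ] Matrix (Fin 3) (Fin 3) ℂ :=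
    { toFun := fun θ => Matrix.of fun i j => θ ![i, j]
      map_add' := fun _ _ => by ext i j; rfl
      map_smul' := fun _ _ => by ext i j; rfl }
  have hbr : Function.Injective br := by
    intro θ θ' h
    funext w
    have e := congr_fun (congr_fun h (w 0)) (w 1)
    have hw : w = ![w 0, w 1] := by ext k; fin_cases k <;> rfl
    rw [hw]
    exact e
  -- STEP 1 (Segre transport): low-rank covectors are carried into the minimal slice layer
  have step1 : ∀ ξ : Fin 2 × (Fin 2 × Fin 2) → ℂ, ξ ≠ 0 →
      (sliceMat (kroneckerTensor (unitTensor ℂ 2) (matMulTensor ℂ 2 2 2)) ξ).rank ≤ 2 →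
      ∃ lam mu : Fin 3 → ℂ, (∃ a, lam a = 0) ∧ (∃ b, mu b = 0) ∧
        T ξ = fun w => lam (w 0) * mu (w 1) := by
    intro ξ hξ0 hρ
    have hθ0 : T ξ ≠ 0 := fun h0 => hξ0 (hA (by rw [h0, map_zero]))
    have hsand := rank_le_rank_sandwich_add hB hC (sliceMat (kroneckerPow D 2) (ξ ᵥ* Matrix.of A))
    rw [← sliceMat_restricts hs ξ] at hsand
    simp only [Fintype.card_prod, Fintype.card_fin, Fintype.card_fun, Nat.reducePow,
      Nat.reduceMul] at hsand
    have hr : (contract3 (kroneckerPow D 2) (T ξ)).rank ≤ 5 := by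
      rw [hTξ, ← sliceMat_eq_contract3]; omega
    exact exists_singular_prod hD (T ξ) hθ0 hr
  -- STEP 2 (the cross lemma, block by block)
  have step2 : ∀ f : Fin 2, ∃ a b : Fin 3, ∀ (p : Fin 2 × Fin 2) (i j : Fin 3),
      (i = a ∨ j = b) → T (Pi.single (f, p) 1) ![i, j] = 0 := by
    intro f
    have hind : LinearIndependent ℂ (fun p : Fin 2 × Fin 2 => br (T (Pi.single (f, p) 1))) := by
      have hli := (((Pi.basisFun ℂ (Fin 2 × (Fin 2 × Fin 2))).linearIndependent.comp
        (fun p : Fin 2 × Fin 2 => (f, p)) (fun p q hpq => (Prod.mk.inj hpq).2)).map' (br ∘ₗ T)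
        (LinearMap.ker_eq_bot.mpr (hbr.comp hA)))
      have e : (fun p : Fin 2 × Fin 2 => br (T (Pi.single (f, p) 1))) =
          ⇑(br ∘ₗ T) ∘ ⇑(Pi.basisFun ℂ (Fin 2 × (Fin 2 × Fin 2))) ∘ fun p => (f, p) := by
        funext p
        simp [Pi.basisFun_apply]
      rw [e]
      exact hli
    have hSP : ∀ u v : Fin 2 → ℂ, u ≠ 0 → v ≠ 0 → ∃ x y : Fin 3 → ℂ,
        (∃ a, x a = 0) ∧ (∃ b, y b = 0) ∧
        ∑ p : Fin 2 × Fin 2, (u p.1 * v p.2) • br (T (Pi.single (f, p) 1)) =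
          Matrix.vecMulVec x y := by
      intro u v hu hv
      have hξ0 : (fun q : Fin 2 × (Fin 2 × Fin 2) => if q.1 = f then u q.2.1 * v q.2.2 else 0)
          ≠ 0 := by
        obtain ⟨i, hi⟩ := Function.ne_iff.mp hu
        obtain ⟨j, hj⟩ := Function.ne_iff.mp hv
        intro h0
        have e := congr_fun h0 (f, (i, j))
        simp only [if_true, Pi.zero_apply, mul_eq_zero] at e
        exact e.elim hi hj
      obtain ⟨lam, mu, ha, hb, hprod⟩ :=
        step1 _ hξ0 (rank_sliceMat_pack_rankOne_le 2 2 f u v)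
      refine ⟨lam, mu, ha, hb, ?_⟩
      have hsum : (fun q : Fin 2 × (Fin 2 × Fin 2) => if q.1 = f then u q.2.1 * v q.2.2 else 0) =
          ∑ p : Fin 2 × Fin 2, (u p.1 * v p.2) • (Pi.single (f, p) (1 : ℂ) : _ → ℂ) := by
        ext q
        simp only [Finset.sum_apply, Pi.smul_apply, smul_eq_mul, Pi.single_apply]
        rw [Finset.sum_eq_single q.2 (fun p _ hp => by simp [Prod.ext_iff, Ne.symm hp]) (by simp)]
        by_cases h : q.1 = f <;> simp [h, Prod.ext_iff]
      calc ∑ p : Fin 2 × Fin 2, (u p.1 * v p.2) • br (T (Pi.single (f, p) 1))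
          = br (T (∑ p : Fin 2 × Fin 2, (u p.1 * v p.2) • (Pi.single (f, p) (1 : ℂ) : _ → ℂ))) := by
            simp [map_sum, map_smul]
        _ = Matrix.vecMulVec lam mu := by
            rw [← hsum, hprod]
            ext i j
            simp [br, Matrix.vecMulVec_apply]
    obtain ⟨a, b, h⟩ := cross_of_bilinear_rank_one hind hSP
    exact ⟨a, b, fun p i j hij => h p i j hij⟩
  -- STEP 3: two distinct words on which every generator of the (8-dimensional) image vanishes
  obtain ⟨a₀, b₀, h0⟩ := step2 0
  obtain ⟨a₁, b₁, h1⟩ := step2 1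
  obtain ⟨w₁, w₂, hw, hv⟩ : ∃ w₁ w₂ : Fin 2 → Fin 3, w₁ ≠ w₂ ∧
      ∀ q : Fin 2 × (Fin 2 × Fin 2), T (Pi.single q 1) w₁ = 0 ∧ T (Pi.single q 1) w₂ = 0 := by
    by_cases ha : a₀ = a₁
    · refine ⟨![a₀, 0], ![a₀, 1], fun h => ?_, ?_⟩
      · have e := congr_fun h 1
        simp at e
      · rintro ⟨f, p⟩
        fin_cases f
        · exact ⟨h0 p _ _ (Or.inl rfl), h0 p _ _ (Or.inl rfl)⟩
        · exact ⟨h1 p _ _ (Or.inl ha), h1 p _ _ (Or.inl ha)⟩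
    · refine ⟨![a₀, b₁], ![a₁, b₀], fun h => ?_, ?_⟩
      · have e := congr_fun h 0
        simp at e
        exact ha e
      · rintro ⟨f, p⟩
        fin_cases f
        · exact ⟨h0 p _ _ (Or.inl rfl), h0 p _ _ (Or.inr rfl)⟩
        · exact ⟨h1 p _ _ (Or.inr rfl), h1 p _ _ (Or.inl rfl)⟩
  exact false_of_range_vanishes (by simp) hA hw hv

/-- **`2·⟨2,2,2⟩ ≰ cw₂^{⊠2}`.**  Two disjoint `2 × 2` matrix products are not a restriction of the
Kronecker square of the Coppersmith–Winograd tensor `T_{cw,2}` (via `D^{⊠2} ≥ cw₂^{⊠2}`,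
`OutsiderSandwichSubrankSix.diagPow_two_restrictsTo_cwPow_two`).  With the tree's
`OutsiderSandwichMMPlusPoint.mmPlusPoint_le_cwPow_two` (`⟨2,2,2⟩ ⊕ ⟨1⟩ ≤ cw₂^{⊠2}`) this decides the
smallest matrix-packing cell of the `cw₂`-tower census: the largest `F` with `F·⟨2,2,2⟩ ≤ cw₂^{⊠2}`
is `F = 1` — below BOTH pencil-law ceilings (`F ≤ 2`). [new] -/
theorem not_pack_two_two_le_cwPow_two :
    ¬ TensorRestrictsTo (kroneckerPow (cwTensor ℂ 2) 2)
      (kroneckerTensor (unitTensor ℂ 2) (matMulTensor ℂ 2 2 2)) := by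
  intro h
  let D' : Fin 3 → Fin 3 → Fin 3 → ℂ := fun a b c => if a ≠ b ∧ b ≠ c ∧ a ≠ c then 1 else 0
  have hD' : ∀ a b c, D' a b c = if a ≠ b ∧ b ≠ c ∧ a ≠ c then 1 else 0 := fun _ _ _ => rfl
  exact not_pack_two_two_le_diagPow_two hD' ((diagPow_two_restrictsTo_cwPow_two hD').trans h)

/-! ## §5  The `(N, m) = (2, 2)` census cell -/

/-- Fewer blocks restrict from more blocks: `⟨F'⟩ ⊗ ⟨m,m,m⟩ ≤ ⟨F⟩ ⊗ ⟨m,m,m⟩` for `F' ≤ F`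
(relabelling along `Fin.castLE`). [folklore] -/
theorem pack_restrictsTo_pack_of_le {F F' : ℕ} (m : ℕ) (h : F' ≤ F) :
    TensorRestrictsTo (kroneckerTensor (unitTensor ℂ F) (matMulTensor ℂ m m m))
      (kroneckerTensor (unitTensor ℂ F') (matMulTensor ℂ m m m)) := by
  classical
  refine ⟨fun a' a => if a = (Fin.castLE h a'.1, a'.2) then 1 else 0,
    fun b' b => if b = (Fin.castLE h b'.1, b'.2) then 1 else 0,
    fun c' c => if c = (Fin.castLE h c'.1, c'.2) then 1 else 0, fun a' b' c' => ?_⟩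
  rw [Finset.sum_eq_single (Fin.castLE h a'.1, a'.2) (fun a _ ha => by simp [ha]) (by simp),
    Finset.sum_eq_single (Fin.castLE h b'.1, b'.2) (fun b _ hb => by simp [hb]) (by simp),
    Finset.sum_eq_single (Fin.castLE h c'.1, c'.2) (fun c _ hc => by simp [hc]) (by simp)]
  simp [kroneckerTensor_apply, unitTensor_apply, (Fin.castLE_injective h).eq_iff]

/-- **The `(N, m) = (2, 2)` census cell is `1`.**  No `F ≥ 2` disjoint copies of `⟨2,2,2⟩` are a
restriction of `cw₂^{⊠2}` — while one copy (indeed `⟨2,2,2⟩ ⊕ ⟨1⟩`) is, by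
`OutsiderSandwichMMPlusPoint.mmPlusPoint_le_cwPow_two`.  The cell value `1` is one full unit below
the coincident slack-law and copy-law ceilings `F ≤ 2`. [new] -/
theorem not_pack_two_le_cwPow_two_of_two_le {F : ℕ} (hF : 2 ≤ F) :
    ¬ TensorRestrictsTo (kroneckerPow (cwTensor ℂ 2) 2)
      (kroneckerTensor (unitTensor ℂ F) (matMulTensor ℂ 2 2 2)) := fun h =>
  not_pack_two_two_le_cwPow_two (h.trans (pack_restrictsTo_pack_of_le 2 hF))

end Summit.MatrixMultiplication.MatrixMultiplication.Theorems.OutsiderSandwichSegreTransport
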